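import Summits.HubbardSuperconductivity.HubbardSuperconductivity.Theorems.ThermalWedgeTwExponentialCeilingConditional
import Summits.HubbardSuperconductivity.HubbardSuperconductivity.Theorems.ThermalWedgeTwPureThermalBoundGsee

/-!
# Route `ThermalWedge` — target item `TwExponentialCeiling` (stmt-HubbardSuperconductivity-1704)
hinges on the crux `TwSourcedInertness` alone

With `TwPureThermalBound` (stmt-1702) now a theorem of the tree (`twPureThermalBound_proof`, whose
body is `TwPureThermalBoundGsee.twPureThermalBound_body`), the two-hypothesis reduction
`twExponentialCeiling_of_pureThermalBound_of_inertness` collapses to a one-hypothesis one: the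
exponential ceiling on the pure model's every-ground-state `d`-wave order is exactly a consequence
of the route's first crux `TwSourcedInertness` (stmt-1696).
-/

set_option linter.dupNamespace false

namespace Summit.HubbardSuperconductivity.HubbardSuperconductivity.Theorems

open Summit.HubbardSuperconductivity.HubbardSuperconductivity.Theses.ThermalWedge

/-- **`TwExponentialCeiling` modulo the crux alone**: `TwSourcedInertness → TwExponentialCeiling`
(the other hypotheses of the glue `TwCeilingGlue` — `TwSectorEnergyLowerBound`,
`TwPureThermalBound`, `TwApproximatingHamiltonian` — and the glue itself are theorems of the tree). -/
theorem twExponentialCeiling_of_inertness (hI : TwSourcedInertness) : TwExponentialCeiling :=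
  twExponentialCeiling_of_pureThermalBound_of_inertness
    TwPureThermalBoundGsee.twPureThermalBound_body hI

end Summit.HubbardSuperconductivity.HubbardSuperconductivity.Theorems
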